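import Mathlib
import Literature.AlgebraicGeometry.Resolution.PolygonInvariants
import Literature.AlgebraicGeometry.Resolution.FormalAxisOfNearChain
import HarnessLib

/-!
# Isolation and the polygon: `α < 1`, `ε < 1`, and Newton points exist

Topic: `Literature/AlgebraicGeometry/Resolution`. Cossart–Piltant 2008, (16): "we have `α(x) < 1`,
since `x` is an isolated point of `Σ`"; Cossart–Jannsen–Saito, LNM 2270, Lemma 11.5: no regular
curve `D ⊆ X_max` through `x` gives `α(f, y, u) < 1` (and `ε < 1` by the same token). The ring
side: `V(y, u₁) ⊆ Σ` means `J ⊆ (y, u₁)^μ` (then `ord J ≥ μ` at the generic point of `V(y, u₁)`).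
We PROVE (no facts), for `J` in a three-dimensional regular local ring with parameters
`c = (y, u₁, u₂)`:

* `alphaS_lt_of_not_le_span_pair_pow` — **`J ⊄ (y, u₁)^μ ⇒ αs < L`**;
* `epsS_lt_of_not_le_span_pair_pow` — **`J ⊄ (y, u₂)^μ ⇒ εs < L`**;
* `pts_nonempty_of_not_le_span_pow` — **`J ⊄ (y^μ) ⇒` Newton points exist**.

Method: Krull (`le_of_forall_le_sup_pow`) yields `K` with `f ∉ I + 𝔪^K`; the weighted ideal of
the weight `(K, K, 1)` (resp. `(K, 1, K)`, `(K, 1, 1)`) at level `K μ` lies inside `I + 𝔪^K`, so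
`f` has an initial term of small weight, i.e. a Newton point with `x₁ < L` (resp. `x₂ < L`,
resp. of `y`-degree `< μ`).

## Sources

* V. Cossart, O. Piltant, J. Algebra 320 (2008), §4, (16). [CossartPiltant2008]
* V. Cossart, U. Jannsen, S. Saito, LNM 2270 (2020), Lemma 11.5. [CossartJannsenSaito2020]
-/

noncomputable section

open IsLocalRing MvPolynomial

namespace Literature.AlgebraicGeometry.Resolution

universe u

section Isolation

variable {R : Type u} [CommRing R] [IsRegularLocalRing R] (c : Fin 3 → R)
  (hgen : Ideal.span {c 0, c 1, c 2} = maximalIdeal R) (hdim : ringKrullDim R = 3)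
  {J : Ideal R} {μ : ℕ}

/-- The weight `(K, K, 1)`. [folklore] -/
def wKK1 (K : ℕ) : Fin 3 → ℕ := ![K, K, 1]
/-- The weight `(K, 1, K)`. [folklore] -/
def wK1K (K : ℕ) : Fin 3 → ℕ := ![K, 1, K]
/-- The weight `(K, 1, 1)`. [folklore] -/
def wK11 (K : ℕ) : Fin 3 → ℕ := ![K, 1, 1]

omit [IsRegularLocalRing R] in
/-- Weights of the three auxiliary weightings. [folklore] -/
theorem weight_wKK1 (K : ℕ) (e : Fin 3 →₀ ℕ) : Finsupp.weight (wKK1 K) e = K * e 0 + K * e 1 + e 2 := by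
  rw [Finsupp.weight_apply, Finsupp.sum_fintype _ _ (by simp)]
  simp [Fin.sum_univ_three, wKK1, mul_comm]

omit [IsRegularLocalRing R] in
/-- Weights of the three auxiliary weightings. [folklore] -/
theorem weight_wK1K (K : ℕ) (e : Fin 3 →₀ ℕ) : Finsupp.weight (wK1K K) e = K * e 0 + e 1 + K * e 2 := by
  rw [Finsupp.weight_apply, Finsupp.sum_fintype _ _ (by simp)]
  simp [Fin.sum_univ_three, wK1K, mul_comm]

omit [IsRegularLocalRing R] in
/-- Weights of the three auxiliary weightings. [folklore] -/
theorem weight_wK11 (K : ℕ) (e : Fin 3 →₀ ℕ) : Finsupp.weight (wK11 K) e = K * e 0 + e 1 + e 2 := by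
  rw [Finsupp.weight_apply, Finsupp.sum_fintype _ _ (by simp)]
  simp [Fin.sum_univ_three, wK11, mul_comm]

omit [IsRegularLocalRing R] in
/-- `F^{(K,K,1)}_{Kμ} ⊆ (y, u₁)^μ + 𝔪^K`. [folklore] -/
theorem weightedIdealW_wKK1_le [IsLocalRing R] (hgen : Ideal.span {c 0, c 1, c 2} = maximalIdeal R)
    (K μ : ℕ) : weightedIdealW c (wKK1 K) (K * μ) ≤ Ideal.span {c 0, c 1} ^ μ ⊔ maximalIdeal R ^ K := by
  rw [weightedIdealW, Ideal.span_le]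
  rintro _ ⟨e, he, rfl⟩
  replace he : K * μ ≤ _ := he
  rw [weight_wKK1] at he
  rw [monom3, SetLike.mem_coe]
  by_cases h : μ ≤ e 0 + e 1
  · refine Ideal.mem_sup_left (Ideal.mul_mem_right _ _ ?_)
    have h0 : c 0 ^ e 0 ∈ Ideal.span {c 0, c 1} ^ e 0 :=
      Ideal.pow_mem_pow (Ideal.subset_span (by simp)) _
    have h1 : c 1 ^ e 1 ∈ Ideal.span {c 0, c 1} ^ e 1 :=
      Ideal.pow_mem_pow (Ideal.subset_span (by simp)) _
    have := Ideal.mul_mem_mul h0 h1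
    rw [← pow_add] at this
    exact Ideal.pow_le_pow_right h this
  · push Not at h
    refine Ideal.mem_sup_right (Ideal.mul_mem_left _ _ ?_)
    have hc2 : c 2 ∈ maximalIdeal R := by rw [← hgen]; exact Ideal.subset_span (by simp)
    have hK : K ≤ e 2 := by
      have : K * (e 0 + e 1) + K ≤ K * μ := by
        rw [← Nat.mul_succ]; exact Nat.mul_le_mul_left _ h
      nlinarith
    exact Ideal.pow_le_pow_right hK (Ideal.pow_mem_pow hc2 _)

omit [IsRegularLocalRing R] in
/-- `F^{(K,1,K)}_{Kμ} ⊆ (y, u₂)^μ + 𝔪^K`. [folklore] -/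
theorem weightedIdealW_wK1K_le [IsLocalRing R] (hgen : Ideal.span {c 0, c 1, c 2} = maximalIdeal R)
    (K μ : ℕ) : weightedIdealW c (wK1K K) (K * μ) ≤ Ideal.span {c 0, c 2} ^ μ ⊔ maximalIdeal R ^ K := by
  rw [weightedIdealW, Ideal.span_le]
  rintro _ ⟨e, he, rfl⟩
  replace he : K * μ ≤ _ := he
  rw [weight_wK1K] at he
  rw [monom3, SetLike.mem_coe]
  by_cases h : μ ≤ e 0 + e 2
  · refine Ideal.mem_sup_left ?_
    have h0 : c 0 ^ e 0 ∈ Ideal.span {c 0, c 2} ^ e 0 :=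
      Ideal.pow_mem_pow (Ideal.subset_span (by simp)) _
    have h2 : c 2 ^ e 2 ∈ Ideal.span {c 0, c 2} ^ e 2 :=
      Ideal.pow_mem_pow (Ideal.subset_span (by simp)) _
    have := Ideal.mul_mem_mul h0 h2
    rw [← pow_add] at this
    have hmem := Ideal.pow_le_pow_right h this
    have : c 0 ^ e 0 * c 1 ^ e 1 * c 2 ^ e 2 = c 1 ^ e 1 * (c 0 ^ e 0 * c 2 ^ e 2) := by ring
    rw [this]; exact Ideal.mul_mem_left _ _ hmem
  · push Not at h
    have hc1 : c 1 ∈ maximalIdeal R := by rw [← hgen]; exact Ideal.subset_span (by simp)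
    have hK : K ≤ e 1 := by
      have : K * (e 0 + e 2) + K ≤ K * μ := by
        rw [← Nat.mul_succ]; exact Nat.mul_le_mul_left _ h
      nlinarith
    refine Ideal.mem_sup_right ?_
    have hmem := Ideal.pow_le_pow_right hK (Ideal.pow_mem_pow hc1 (e 1))
    have : c 0 ^ e 0 * c 1 ^ e 1 * c 2 ^ e 2 = (c 0 ^ e 0 * c 2 ^ e 2) * c 1 ^ e 1 := by ring
    rw [this]; exact Ideal.mul_mem_left _ _ hmem

omit [IsRegularLocalRing R] in
/-- `F^{(K,1,1)}_{Kμ} ⊆ (y^μ) + 𝔪^K`. [folklore] -/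
theorem weightedIdealW_wK11_le [IsLocalRing R] (hgen : Ideal.span {c 0, c 1, c 2} = maximalIdeal R)
    (K μ : ℕ) : weightedIdealW c (wK11 K) (K * μ) ≤ Ideal.span {c 0 ^ μ} ⊔ maximalIdeal R ^ K := by
  rw [weightedIdealW, Ideal.span_le]
  rintro _ ⟨e, he, rfl⟩
  replace he : K * μ ≤ _ := he
  rw [weight_wK11] at he
  rw [monom3, SetLike.mem_coe]
  by_cases h : μ ≤ e 0
  · refine Ideal.mem_sup_left ?_
    have : c 0 ^ e 0 * c 1 ^ e 1 * c 2 ^ e 2 = c 0 ^ μ * (c 0 ^ (e 0 - μ) * c 1 ^ e 1 * c 2 ^ e 2) := by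
      rw [← mul_assoc, ← mul_assoc, ← pow_add, Nat.add_sub_cancel' h]
    rw [this]; exact Ideal.mul_mem_right _ _ (Ideal.subset_span rfl)
  · push Not at h
    have hc1 : c 1 ∈ maximalIdeal R := by rw [← hgen]; exact Ideal.subset_span (by simp)
    have hc2 : c 2 ∈ maximalIdeal R := by rw [← hgen]; exact Ideal.subset_span (by simp)
    have hK : K ≤ e 1 + e 2 := by
      have : K * e 0 + K ≤ K * μ := by rw [← Nat.mul_succ]; exact Nat.mul_le_mul_left _ h
      omega
    refine Ideal.mem_sup_right ?_
    have hmem : c 1 ^ e 1 * c 2 ^ e 2 ∈ maximalIdeal R ^ (e 1 + e 2) := by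
      rw [pow_add]; exact Ideal.mul_mem_mul (Ideal.pow_mem_pow hc1 _) (Ideal.pow_mem_pow hc2 _)
    have : c 0 ^ e 0 * c 1 ^ e 1 * c 2 ^ e 2 = c 0 ^ e 0 * (c 1 ^ e 1 * c 2 ^ e 2) := by ring
    rw [this]; exact Ideal.mul_mem_left _ _ (Ideal.pow_le_pow_right hK hmem)

omit [IsRegularLocalRing R] in
/-- Krull, elementwise: `f ∉ I ⇒ ∃ K, f ∉ I + 𝔪^K`. [cite: Matsumura1987, Thm. 8.10] -/
theorem exists_not_mem_sup_pow [IsNoetherianRing R] [IsLocalRing R] {I : Ideal R} {f : R}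
    (hf : f ∉ I) : ∃ K, f ∉ I ⊔ maximalIdeal R ^ K := by
  by_contra h
  push Not at h
  have : Ideal.span {f} ≤ I :=
    le_of_forall_le_sup_pow fun n => (Ideal.span_singleton_le_iff_mem _).mpr (h n)
  exact hf (this (Ideal.subset_span rfl))

include hgen hdim in
/-- **`J ⊄ (y, u₁)^μ ⇒ α < 1`** (scaled: `αs < L`): some Newton point has `x₁ < L`.
[cite: CossartPiltant2008, (16)] [cite: CossartJannsenSaito2020, Lemma 11.5] -/
theorem alphaS_lt_of_not_le_span_pair_pow (hJ : ¬ J ≤ Ideal.span {c 0, c 1} ^ μ) :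
    (pts c J μ).Nonempty ∧ alphaS c J μ < μ.factorial := by
  classical
  obtain ⟨f, hfJ, hf⟩ := Set.not_subset.mp hJ
  obtain ⟨K₀, hK₀⟩ := exists_not_mem_sup_pow hf
  set K := K₀ + 1 with hK
  have hfK : f ∉ Ideal.span {c 0, c 1} ^ μ ⊔ maximalIdeal R ^ K := fun h =>
    hK₀ (sup_le_sup_left (Ideal.pow_le_pow_right (by omega : K₀ ≤ K)) (Ideal.span {c 0, c 1} ^ μ) h)
  have hw : ∀ i, 0 < wKK1 K i := fun i => by
    fin_cases i
    · show 0 < K; omega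
    · show 0 < K; omega
    · show 0 < 1; omega
  have hfW : f ∉ weightedIdealW c (wKK1 K) (K * μ) := fun h => hfK (weightedIdealW_wKK1_le c hgen K μ h)
  rw [mem_weightedIdealW_iff_forall_isInitialTerm c hgen hdim hw] at hfW
  push Not at hfW
  obtain ⟨e, he, hlt⟩ := hfW
  rw [weight_wKK1] at hlt
  have h01 : e 0 + e 1 + 1 ≤ μ := by
    by_contra h'
    push Not at h'
    have : K * μ ≤ K * (e 0 + e 1) := Nat.mul_le_mul_left _ (by omega)
    rw [Nat.mul_add] at this; omega
  have he0 : e 0 < μ := by omega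
  have hpts : e ∈ pts c J μ := ⟨mem_occ_of_isInitialTerm c hfJ hw he, he0⟩
  refine ⟨⟨e, hpts⟩, lt_of_le_of_lt (alphaS_le hpts) ?_⟩
  rw [spt₁, ← sub_mul_sfac he0]
  exact Nat.mul_lt_mul_of_pos_right (by omega) (sfac_pos he0)

include hgen hdim in
/-- **`J ⊄ (y, u₂)^μ ⇒ ε < 1`** (scaled: `εs < L`): some Newton point has `x₂ < L`.
[cite: CossartPiltant2008, (16)] [cite: CossartJannsenSaito2020, Lemma 11.5] -/
theorem epsS_lt_of_not_le_span_pair_pow (hJ : ¬ J ≤ Ideal.span {c 0, c 2} ^ μ) :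
    (pts c J μ).Nonempty ∧ epsS c J μ < μ.factorial := by
  classical
  obtain ⟨f, hfJ, hf⟩ := Set.not_subset.mp hJ
  obtain ⟨K₀, hK₀⟩ := exists_not_mem_sup_pow hf
  set K := K₀ + 1 with hK
  have hfK : f ∉ Ideal.span {c 0, c 2} ^ μ ⊔ maximalIdeal R ^ K := fun h =>
    hK₀ (sup_le_sup_left (Ideal.pow_le_pow_right (by omega : K₀ ≤ K)) (Ideal.span {c 0, c 2} ^ μ) h)
  have hw : ∀ i, 0 < wK1K K i := fun i => by
    fin_cases i
    · show 0 < K; omega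
    · show 0 < 1; omega
    · show 0 < K; omega
  have hfW : f ∉ weightedIdealW c (wK1K K) (K * μ) := fun h => hfK (weightedIdealW_wK1K_le c hgen K μ h)
  rw [mem_weightedIdealW_iff_forall_isInitialTerm c hgen hdim hw] at hfW
  push Not at hfW
  obtain ⟨e, he, hlt⟩ := hfW
  rw [weight_wK1K] at hlt
  have h02 : e 0 + e 2 + 1 ≤ μ := by
    by_contra h'
    push Not at h'
    have : K * μ ≤ K * (e 0 + e 2) := Nat.mul_le_mul_left _ (by omega)
    rw [Nat.mul_add] at this; omega
  have he0 : e 0 < μ := by omega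
  have hpts : e ∈ pts c J μ := ⟨mem_occ_of_isInitialTerm c hfJ hw he, he0⟩
  refine ⟨⟨e, hpts⟩, lt_of_le_of_lt (epsS_le hpts) ?_⟩
  rw [spt₂, ← sub_mul_sfac he0]
  exact Nat.mul_lt_mul_of_pos_right (by omega) (sfac_pos he0)

include hgen hdim in
/-- **`J ⊄ (y^μ) ⇒` Newton points exist.** [cite: CossartJannsenSaito2020, Def. 8.4] -/
theorem pts_nonempty_of_not_le_span_pow (hJ : ¬ J ≤ Ideal.span {c 0 ^ μ}) : (pts c J μ).Nonempty := by
  classical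
  obtain ⟨f, hfJ, hf⟩ := Set.not_subset.mp hJ
  obtain ⟨K₀, hK₀⟩ := exists_not_mem_sup_pow hf
  set K := K₀ + 1 with hK
  have hfK : f ∉ Ideal.span {c 0 ^ μ} ⊔ maximalIdeal R ^ K := fun h =>
    hK₀ (sup_le_sup_left (Ideal.pow_le_pow_right (by omega : K₀ ≤ K)) (Ideal.span {c 0 ^ μ}) h)
  have hw : ∀ i, 0 < wK11 K i := fun i => by
    fin_cases i
    · show 0 < K; omega
    · show 0 < 1; omega
    · show 0 < 1; omega
  have hfW : f ∉ weightedIdealW c (wK11 K) (K * μ) := fun h => hfK (weightedIdealW_wK11_le c hgen K μ h)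
  rw [mem_weightedIdealW_iff_forall_isInitialTerm c hgen hdim hw] at hfW
  push Not at hfW
  obtain ⟨e, he, hlt⟩ := hfW
  rw [weight_wK11] at hlt
  have he0 : e 0 < μ := by
    by_contra h'
    push Not at h'
    have : K * μ ≤ K * e 0 := Nat.mul_le_mul_left _ h'
    omega
  exact ⟨e, mem_occ_of_isInitialTerm c hfJ hw he, he0⟩

end Isolation

end Literature.AlgebraicGeometry.Resolution
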